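import Summits.Ventures.YMGap.RobustBall.TorusOneLinkFine
import Summits.Ventures.YMGap.RobustBall.TorusClustering
import HarnessLib

/-!
# Venture YMGap, track ROBUST-BALL (Y2) — the robust TORUS door and torus-uniform clustering on the READS-INCIDENCE
ball (`FineBall`): the upgrade of `TorusDoor` / `TorusClustering`

HONEST FRAMING. WHAT THIS IS: a venture file (cell `pub-ymgap`, track Y2 ROBUST-BALL, seat ds-2): the same door as
`TorusDoor` with every load replaced by its READS-INCIDENCE version (`oscLoadF / selfLipLoadF / crossLipF / crossLipLoadF`
of rb-theory's `FineBall.lean`) — strictly STRONGER, since the fine ball `ClusterDomainFRFine ε₀ ε₁ r ⊇ ClusterDomainFR ε₀ ε₁ r`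
(`mem_fine_of_mem`) and the named-action windows are `×d` wider (p1's count). Entry
`C_F(e,y) = K e^{a_F(e)} (1 + 2√N ℓ_{s,F}(e)) (|β|/N) n(e,y) + √N ℓ_F(e,y)` (ds-4's `su_oneLink_robust_influence` on the fine
re-weighting function of `TorusOneLinkFine`), rows `≤ rhoFR N c_W ε₀ ε₁` on the fine ball, hence
`robustTorusDoorFine_holds : RobustTorusDoorFine N d β ε₀ ε₁ r (rhoFR N (K(|β|/N)6(d−1)) ε₀ ε₁)` and the clustering currencies
`torusClusteringOnBallFine_of_oneLinkKRModulus`, `torusClusteringOnBallWFine_of_oneLinkKRModulus` (constant `8N`, rates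
`−log ρ/(r ⊔ 1)` and `κ`), for `d, N ≥ 1`. WHAT THIS IS NOT: no new analysis beyond the `g`-constancy step; no number;
lattice strong-coupling statements on finite tori — no continuum, no Millennium claim.

## References
* The tree: `FineBall.lean` (rb-theory), `TorusDoor.lean` / `TorusClustering.lean` (this seat, landed ball),
  `Thresholds/OneLinkTiltStability.lean` (ds-4). H. Föllmer, LNM 1362 (1988), Ch. I (2.7)–(2.24).
-/

noncomputable section

open MeasureTheory ProbabilityTheory Finset Function Real
open Literature.Probability.LatticeModels Literature.Probability.LatticeModels.DobrushinMetric
open Literature.MathematicalPhysics.QuantumLattice hiding torusNorm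
open Literature.MathematicalPhysics.QuantumFieldTheory hiding ZdEdge
open Literature.MathematicalPhysics.QuantumFieldTheory.Balaban1983to89.StrongCouplingTorusWindow
open Literature.MathematicalPhysics.QuantumFieldTheory.Balaban1983to89.StrongCouplingDobrushinWindow
  (OneLinkKRModulus)

namespace Summit.Ventures.YMGap.RobustBall

variable {d L N : ℕ} [NeZero L] {W : Perturbation d L N}

/-! ### The fine entry and Dobrushin's condition -/

/-- **The robust Dobrushin entry with FINE loads**: for `ω = η` off `y ≠ e`,
`|γ_e(φ|ω) − γ_e(φ|η)| ≤ (K e^{a_F(e)} (1 + 2√N ℓ_{s,F}(e)) (|β|/N) n(e,y) + √N ℓ_F(e,y)) · Lφ · ‖ω_y − η_y‖_F`. [folklore] -/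
theorem abs_integral_siteLaw_sub_le_fine (hd : 1 ≤ d) (hN : 1 ≤ N) (hL : 1 < L) {β R K : ℝ} (hK : 0 ≤ K)
    (hR : |β| / N * (2 * ((d : ℝ) - 1)) ≤ R) (hmod : OneLinkKRModulus N R K) (w : LoadWitness W)
    {e y : Edge d L} (hye : y ≠ e) {ω η : GaugeConfig d L (SUN N)} (hωη : ∀ z, z ≠ y → ω z = η z)
    (φ : SUN N → ℝ) (Lφ : ℝ) (hφm : Measurable φ) (hφb : ∃ M, ∀ s, |φ s| ≤ M) (hLφ : 0 ≤ Lφ)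
    (hφL : ∀ a b, |φ a - φ b| ≤ Lφ * suFrobDist a b) :
    |∫ s, φ s ∂(siteLaw (perturbedTorusSpec W β) e ω) - ∫ s, φ s ∂(siteLaw (perturbedTorusSpec W β) e η)| ≤
      (K * Real.exp (w.oscLoadF 0 e) * (1 + 2 * Real.sqrt N * w.selfLipLoadF 0 e) * (|β| / N) * tInfluence e y +
        Real.sqrt N * w.crossLipF 0 e y) * Lφ * suFrobDist (ω y) (η y) := by
  rw [siteLaw_perturbedTorusSpec_thooft_fine W β hL hN e ω, siteLaw_perturbedTorusSpec_thooft_fine W β hL hN e η]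
  obtain ⟨M, hM⟩ := exists_abs_fineTilt_le W e
  have key := OneLinkTiltStability.su_oneLink_robust_influence (N := N) (δ := w.oscLoadF 0 e)
    (ℓ := w.selfLipLoadF 0 e) (s := w.crossLipF 0 e y * suFrobDist (ω y) (η y)) (selfLipLoadF_nonneg w 0 e) hmod
    (tField β e ω) (tField β e η) ((matrixOpNorm_tField_le hd hN β e ω).trans hR)
    ((matrixOpNorm_tField_le hd hN β e η).trans hR)
    (fun g => ∑ X ∈ polymersReading W e, W.act X (update ω e g))
    (fun g => ∑ X ∈ polymersReading W e, W.act X (update η e g))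
    (measurable_fineTilt W e ω) (measurable_fineTilt W e η) ⟨M, hM η⟩
    (fun g g' => fineTilt_sub_le_oscLoadF w e ω g g') (fun g g' => abs_fineTilt_sub_le_selfLipLoadF w e ω g g')
    (fun g => abs_fineTilt_sub_fineTilt_le_crossLipF w hye hωη g) φ Lφ hφm hφb hLφ hφL
  refine key.trans ?_
  have hT : 0 ≤ K * Real.exp (w.oscLoadF 0 e) * (1 + 2 * Real.sqrt N * w.selfLipLoadF 0 e) :=
    mul_nonneg (mul_nonneg hK (Real.exp_pos _).le)
      (add_nonneg zero_le_one (mul_nonneg (by positivity) (selfLipLoadF_nonneg w 0 e)))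
  have hB := frobNorm_tField_sub_le hL β e y hωη
  calc (K * Real.exp (w.oscLoadF 0 e) * (1 + 2 * Real.sqrt N * w.selfLipLoadF 0 e) *
          frobNorm (tField β e ω - tField β e η) + Real.sqrt N * (w.crossLipF 0 e y * suFrobDist (ω y) (η y))) * Lφ
      ≤ (K * Real.exp (w.oscLoadF 0 e) * (1 + 2 * Real.sqrt N * w.selfLipLoadF 0 e) *
          (|β| / N * tInfluence e y * suFrobDist (ω y) (η y)) +
          Real.sqrt N * (w.crossLipF 0 e y * suFrobDist (ω y) (η y))) * Lφ :=
        mul_le_mul_of_nonneg_right (add_le_add (mul_le_mul_of_nonneg_left hB hT) le_rfl) hLφ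
    _ = _ := by ring

/-- The fine entries are nonnegative. [folklore] -/
theorem fineEntry_nonneg {K : ℝ} (hK : 0 ≤ K) (β : ℝ) (w : LoadWitness W) (e y : Edge d L) :
    0 ≤ K * Real.exp (w.oscLoadF 0 e) * (1 + 2 * Real.sqrt N * w.selfLipLoadF 0 e) * (|β| / N) * tInfluence e y +
        Real.sqrt N * w.crossLipF 0 e y :=
  add_nonneg (mul_nonneg (mul_nonneg (mul_nonneg (mul_nonneg hK (Real.exp_pos _).le)
    (add_nonneg zero_le_one (mul_nonneg (by positivity) (selfLipLoadF_nonneg w 0 e)))) (by positivity))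
    (Nat.cast_nonneg _)) (mul_nonneg (Real.sqrt_nonneg _) (crossLipF_nonneg w 0 e y))

/-- **Dobrushin's condition with the FINE matrix, all links as neighbours.** [folklore] -/
theorem isKRContraction_perturbedTorusSpec_fine (hd : 1 ≤ d) (hN : 1 ≤ N) (hL : 1 < L) {β R K : ℝ} (hK : 0 ≤ K)
    (hR : |β| / N * (2 * ((d : ℝ) - 1)) ≤ R) (hmod : OneLinkKRModulus N R K) (w : LoadWitness W) :
    IsKRContraction (perturbedTorusSpec W β) suFrobDist (fun e => univ.erase e) fun e y =>
      K * Real.exp (w.oscLoadF 0 e) * (1 + 2 * Real.sqrt N * w.selfLipLoadF 0 e) * (|β| / N) * tInfluence e y +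
        Real.sqrt N * w.crossLipF 0 e y := by
  refine ⟨fun e => Finset.notMem_erase e _, fun e y => fineEntry_nonneg hK β w e y,
    fun e η η' h => siteLaw_perturbedTorusSpec_congr_off β e fun z hz =>
      h z (Finset.mem_erase.2 ⟨hz, Finset.mem_univ _⟩),
    fun e y hy ω η hωη φ L' hφm hφb hL' hφL => ?_⟩
  exact abs_integral_siteLaw_sub_le_fine hd hN hL hK hR hmod w (Finset.mem_erase.1 hy).1 hωη φ L' hφm hφb hL' hφL

/-- **Dobrushin's condition with the FINE matrix, neighbourhoods of range `r ⊔ 1`** (tier-1 members). [folklore] -/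
theorem isKRContraction_perturbedTorusSpec_fine_of_hasRange (hd : 1 ≤ d) (hN : 1 ≤ N) (hL : 1 < L) {β R K : ℝ}
    (hK : 0 ≤ K) (hR : |β| / N * (2 * ((d : ℝ) - 1)) ≤ R) (hmod : OneLinkKRModulus N R K) (w : LoadWitness W)
    {r : ℕ} (hr : HasRange r W) :
    IsKRContraction (perturbedTorusSpec W β) suFrobDist
      (fun e => (univ.erase e).filter fun y => torusNorm (e.1 - y.1) ≤ max r 1) fun e y =>
      K * Real.exp (w.oscLoadF 0 e) * (1 + 2 * Real.sqrt N * w.selfLipLoadF 0 e) * (|β| / N) * tInfluence e y +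
        Real.sqrt N * w.crossLipF 0 e y := by
  refine ⟨fun e h => Finset.notMem_erase e _ (Finset.mem_filter.1 h).1, fun e y => fineEntry_nonneg hK β w e y,
    fun e η η' h => siteLaw_perturbedTorusSpec_congr_of_hasRange β hr e h,
    fun e y hy ω η hωη φ L' hφm hφb hL' hφL => ?_⟩
  exact abs_integral_siteLaw_sub_le_fine hd hN hL hK hR hmod w (Finset.mem_erase.1 (Finset.mem_filter.1 hy).1).1 hωη
    φ L' hφm hφb hL' hφL

/-! ### Fine row sums -/

/-- **Weighted fine cross row** (`t ≥ 0`): `∑_{y ≠ e} ℓ_{F,0}(e,y) e^{t‖e−y‖_∞} ≤ Λ_{F,t}(e)` — a polymer reading both `e`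
and `y` has both links in its site-incidence link set (`mem_polymerEdges_of_reads`), hence `‖e − y‖_∞ ≤ diam X`. [folklore] -/
theorem sum_erase_crossLipF_mul_exp_le (w : LoadWitness W) {t : ℝ} (ht : 0 ≤ t) (e : Edge d L) :
    ∑ y ∈ univ.erase e, w.crossLipF 0 e y * Real.exp (t * torusNorm (e.1 - y.1)) ≤ w.crossLipLoadF t e := by
  classical
  unfold LoadWitness.crossLipLoadF
  refine Finset.sum_le_sum fun y _ => ?_
  unfold LoadWitness.crossLipF
  rw [Finset.sum_mul]
  refine Finset.sum_le_sum fun X hX => ?_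
  obtain ⟨hXe, hXy⟩ := Finset.mem_filter.1 hX
  have heX : e.1 ∈ X := (mem_polymersThroughEdge.1 (polymersReading_subset W e hXe)).2
  have hyX : y.1 ∈ X := mem_polymerEdges_one.1 (mem_polymerEdges_of_reads hXy)
  rw [zero_mul, Real.exp_zero, one_mul, mul_comm]
  refine mul_le_mul_of_nonneg_right (Real.exp_le_exp.2 (mul_le_mul_of_nonneg_left ?_ ht)) ((w.lip_spec X).nonneg y)
  exact_mod_cast torusNorm_sub_le_polymerDiam heX hyX

/-- **Row sum of the fine matrix**: `≤ K e^{a_F(e)} (1 + 2√N ℓ_{s,F}(e)) (|β|/N) 6(d−1) + √N Λ_{F,0}(e)`. [folklore] -/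
theorem sum_erase_fineEntry_le (hd : 1 ≤ d) (hL : 1 < L) {K : ℝ} (hK : 0 ≤ K) (β : ℝ) (w : LoadWitness W)
    (e : Edge d L) :
    ∑ y ∈ univ.erase e, (K * Real.exp (w.oscLoadF 0 e) * (1 + 2 * Real.sqrt N * w.selfLipLoadF 0 e) * (|β| / N) *
        tInfluence e y + Real.sqrt N * w.crossLipF 0 e y) ≤
      K * Real.exp (w.oscLoadF 0 e) * (1 + 2 * Real.sqrt N * w.selfLipLoadF 0 e) * (|β| / N) * (6 * ((d : ℝ) - 1)) +
        Real.sqrt N * w.crossLipLoadF 0 e := by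
  have h0 := sum_erase_crossLipF_mul_exp_le w le_rfl e
  simp only [zero_mul, Real.exp_zero, mul_one] at h0
  rw [Finset.sum_add_distrib, ← Finset.mul_sum, ← Finset.mul_sum]
  have hT : 0 ≤ K * Real.exp (w.oscLoadF 0 e) * (1 + 2 * Real.sqrt N * w.selfLipLoadF 0 e) * (|β| / N) :=
    mul_nonneg (mul_nonneg (mul_nonneg hK (Real.exp_pos _).le)
      (add_nonneg zero_le_one (mul_nonneg (by positivity) (selfLipLoadF_nonneg w 0 e)))) (by positivity)
  exact add_le_add (mul_le_mul_of_nonneg_left (sum_erase_tInfluence_le hd hL e) hT)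
    (mul_le_mul_of_nonneg_left h0 (Real.sqrt_nonneg _))

/-- **Weighted row sum of the fine matrix** (`t ≥ 0`). [folklore] -/
theorem sum_erase_fineEntry_mul_exp_le (hd : 1 ≤ d) (hL : 1 < L) {K : ℝ} (hK : 0 ≤ K) (β : ℝ) (w : LoadWitness W)
    {t : ℝ} (ht : 0 ≤ t) (e : Edge d L) :
    ∑ y ∈ univ.erase e, (K * Real.exp (w.oscLoadF 0 e) * (1 + 2 * Real.sqrt N * w.selfLipLoadF 0 e) * (|β| / N) *
        tInfluence e y + Real.sqrt N * w.crossLipF 0 e y) * Real.exp (t * torusNorm (e.1 - y.1)) ≤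
      Real.exp t * K * Real.exp (w.oscLoadF 0 e) * (1 + 2 * Real.sqrt N * w.selfLipLoadF 0 e) * (|β| / N) *
          (6 * ((d : ℝ) - 1)) + Real.sqrt N * w.crossLipLoadF t e := by
  have hT : 0 ≤ K * Real.exp (w.oscLoadF 0 e) * (1 + 2 * Real.sqrt N * w.selfLipLoadF 0 e) * (|β| / N) :=
    mul_nonneg (mul_nonneg (mul_nonneg hK (Real.exp_pos _).le)
      (add_nonneg zero_le_one (mul_nonneg (by positivity) (selfLipLoadF_nonneg w 0 e)))) (by positivity)
  have hsplit : ∀ y ∈ univ.erase e,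
      (K * Real.exp (w.oscLoadF 0 e) * (1 + 2 * Real.sqrt N * w.selfLipLoadF 0 e) * (|β| / N) * tInfluence e y +
          Real.sqrt N * w.crossLipF 0 e y) * Real.exp (t * torusNorm (e.1 - y.1)) =
        K * Real.exp (w.oscLoadF 0 e) * (1 + 2 * Real.sqrt N * w.selfLipLoadF 0 e) * (|β| / N) *
            ((tInfluence e y : ℝ) * Real.exp (t * torusNorm (e.1 - y.1))) +
          Real.sqrt N * (w.crossLipF 0 e y * Real.exp (t * torusNorm (e.1 - y.1))) := fun y _ => by ring
  rw [Finset.sum_congr rfl hsplit, Finset.sum_add_distrib, ← Finset.mul_sum, ← Finset.mul_sum]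
  refine add_le_add ?_ (mul_le_mul_of_nonneg_left (sum_erase_crossLipF_mul_exp_le w ht e) (Real.sqrt_nonneg _))
  calc K * Real.exp (w.oscLoadF 0 e) * (1 + 2 * Real.sqrt N * w.selfLipLoadF 0 e) * (|β| / N) *
          ∑ y ∈ univ.erase e, (tInfluence e y : ℝ) * Real.exp (t * torusNorm (e.1 - y.1))
      ≤ K * Real.exp (w.oscLoadF 0 e) * (1 + 2 * Real.sqrt N * w.selfLipLoadF 0 e) * (|β| / N) *
          (Real.exp t * (6 * ((d : ℝ) - 1))) :=
        mul_le_mul_of_nonneg_left (sum_erase_tInfluence_mul_exp_le hd hL ht e) hT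
    _ = _ := by ring

/-! ### The fine doors and clustering currencies -/

/-- **THE ROBUST TORUS DOOR ON THE READS-INCIDENCE BALL (tier 1)** from any one-link modulus (`d, N ≥ 1`):
`RobustTorusDoorFine N d β ε₀ ε₁ r (rhoFR N (K (|β|/N) 6(d−1)) ε₀ ε₁)`. [folklore] -/
theorem robustTorusDoorFine_holds (hd : 1 ≤ d) (hN : 1 ≤ N) {β ε₀ ε₁ R K : ℝ} (hK : 0 ≤ K)
    (hR : |β| / N * (2 * ((d : ℝ) - 1)) ≤ R) (hmod : OneLinkKRModulus N R K) (r : ℕ) :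
    RobustTorusDoorFine N d β ε₀ ε₁ r (rhoFR N (K * (|β| / N) * (6 * ((d : ℝ) - 1))) ε₀ ε₁) := by
  intro L _ hL W hW
  obtain ⟨hr, w, hwa, hwℓ⟩ := hW
  have hL1 : 1 < L := by omega
  have hd1 : (0 : ℝ) ≤ (d : ℝ) - 1 := by
    have : (1 : ℝ) ≤ d := by exact_mod_cast hd
    linarith
  refine ⟨fun e => (univ.erase e).filter fun y => torusNorm (e.1 - y.1) ≤ max r 1, _,
    isKRContraction_perturbedTorusSpec_fine_of_hasRange hd hN hL1 hK hR hmod w hr, fun e => ?_,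
    fun e y hy => (Finset.mem_filter.1 hy).2⟩
  refine le_trans (Finset.sum_le_sum_of_subset_of_nonneg (Finset.filter_subset _ _)
    fun y _ _ => fineEntry_nonneg hK β w e y) ?_
  refine (sum_erase_fineEntry_le hd hL1 hK β w e).trans ?_
  have hcW : 0 ≤ K * (|β| / N) * (6 * ((d : ℝ) - 1)) := by positivity
  have key := row_le_rhoFR (N := N) hcW (hwa e) (selfLipLoadF_nonneg w 0 e) (crossLipLoadF_nonneg w 0 e) (hwℓ e)
  calc K * Real.exp (w.oscLoadF 0 e) * (1 + 2 * Real.sqrt N * w.selfLipLoadF 0 e) * (|β| / N) * (6 * ((d : ℝ) - 1)) +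
        Real.sqrt N * w.crossLipLoadF 0 e
      = Real.exp (w.oscLoadF 0 e) * (1 + 2 * Real.sqrt N * w.selfLipLoadF 0 e) * (K * (|β| / N) * (6 * ((d : ℝ) - 1))) +
        Real.sqrt N * w.crossLipLoadF 0 e := by ring
    _ ≤ _ := key

/-- **Torus clustering on the reads-incidence tier-1 ball** (`d, N ≥ 1`): with `ρ = rhoFR N (K (|β|/N) 6(d−1)) ε₀ ε₁ ∈ (0,1)`,
`TorusClusteringOnBallFine N d β ε₀ ε₁ r (8N) (−log ρ/(r ⊔ 1))` — implies the landed `TorusClusteringOnBall` row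
(`torusClusteringOnBall_of_fine`). [folklore] -/
theorem torusClusteringOnBallFine_of_oneLinkKRModulus (hd : 1 ≤ d) (hN : 1 ≤ N) {β ε₀ ε₁ R K : ℝ} (hK : 0 ≤ K)
    (hR : |β| / N * (2 * ((d : ℝ) - 1)) ≤ R) (hmod : OneLinkKRModulus N R K) (r : ℕ)
    (hρ0 : 0 < rhoFR N (K * (|β| / N) * (6 * ((d : ℝ) - 1))) ε₀ ε₁)
    (hρ1 : rhoFR N (K * (|β| / N) * (6 * ((d : ℝ) - 1))) ε₀ ε₁ < 1) :
    TorusClusteringOnBallFine N d β ε₀ ε₁ r (8 * N)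
      (-Real.log (rhoFR N (K * (|β| / N) * (6 * ((d : ℝ) - 1))) ε₀ ε₁) / max r 1) := by
  intro L _ hL W hW
  obtain ⟨nbr, C, hKR, hrow, hnbr⟩ := robustTorusDoorFine_holds hd hN hK hR hmod r L hL W hW
  have h := clustersWith_of_isKRContraction hKR hρ0 hρ1.le hrow (r₁ := max r 1) (le_max_right _ _) hnbr
  simpa [Nat.cast_max] using h

/-- **Torus clustering on the reads-incidence tier-2 ball** (`d, N ≥ 1`, `κ ≥ 0`): rate `κ`, constant `8N`, whenever
`rhoFR N (e^{κ} K (|β|/N) 6(d−1)) ε₀ ε₁ < 1`. [folklore] -/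
theorem torusClusteringOnBallWFine_of_oneLinkKRModulus (hd : 1 ≤ d) (hN : 1 ≤ N) {β κ ε₀ ε₁ R K : ℝ} (hK : 0 ≤ K)
    (hκ : 0 ≤ κ) (hR : |β| / N * (2 * ((d : ℝ) - 1)) ≤ R) (hmod : OneLinkKRModulus N R K) (hε₁ : 0 ≤ ε₁)
    (hρ1 : rhoFR N (Real.exp κ * K * (|β| / N) * (6 * ((d : ℝ) - 1))) ε₀ ε₁ < 1) :
    TorusClusteringOnBallWFine N d β κ ε₀ ε₁ (8 * N) κ := by
  intro L _ hL W hW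
  obtain ⟨w, hwa, hwℓ⟩ := hW
  have hL1 : 1 < L := by omega
  have hd1 : (0 : ℝ) ≤ (d : ℝ) - 1 := by
    have : (1 : ℝ) ≤ d := by exact_mod_cast hd
    linarith
  have hρ0 : 0 ≤ rhoFR N (Real.exp κ * K * (|β| / N) * (6 * ((d : ℝ) - 1))) ε₀ ε₁ :=
    le_trans (by positivity) (le_max_left _ _)
  refine clustersWith_of_isKRContraction_weighted (isKRContraction_perturbedTorusSpec_fine hd hN hL1 hK hR hmod w)
    hκ hρ0 hρ1 fun e => ?_
  refine (sum_erase_fineEntry_mul_exp_le hd hL1 hK β w hκ e).trans ?_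
  have hcW : 0 ≤ Real.exp κ * K * (|β| / N) * (6 * ((d : ℝ) - 1)) := by positivity
  have key := row_le_rhoFR (N := N) hcW ((oscLoadF_zero_le w hκ e).trans (hwa e))
    (selfLipLoadF_nonneg w 0 e) (crossLipLoadF_nonneg w κ e)
    (le_trans (add_le_add (selfLipLoadF_zero_le w hκ e) le_rfl) (hwℓ e))
  calc Real.exp κ * K * Real.exp (w.oscLoadF 0 e) * (1 + 2 * Real.sqrt N * w.selfLipLoadF 0 e) * (|β| / N) *
          (6 * ((d : ℝ) - 1)) + Real.sqrt N * w.crossLipLoadF κ e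
      = Real.exp (w.oscLoadF 0 e) * (1 + 2 * Real.sqrt N * w.selfLipLoadF 0 e) *
          (Real.exp κ * K * (|β| / N) * (6 * ((d : ℝ) - 1))) + Real.sqrt N * w.crossLipLoadF κ e := by ring
    _ ≤ _ := key

end Summit.Ventures.YMGap.RobustBall

end
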